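import Literature.AlgebraicGeometry.Shioda1982.StandardQuadrupleTwoThreePower
import Literature.AlgebraicGeometry.Shioda1982.HodgeQuadruplesTenPrime
import HarnessLib

/-!
# Standard-or-lift with a general level bound: the vocabulary of the induction over ALL levels, and the reduction to primitive quadruples

Topic `Literature/AlgebraicGeometry/Shioda1982`. Two definitions of record (`IsLiftLe`, `StdOrLift`: the bounded-lift
vocabulary, generalising `IsSmallLift` / `StdOrSmall` of `HodgeQuadruplesTwoThreePowerStep` / `StandardQuadrupleTwoThreePower` from
the bound `72` to an arbitrary bound `B`) and THEOREMS; no named fact, no `sorry`. Written for the last levels of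
[Aoki1983, Thm. C] = [AokiShioda1983, Thm. (𝔅²ₘ) (ii)] = [Shioda1982PicardFermat, Prop. 4 (Q′)] not yet in the tree (the levels
`2ᵃ3ᵇ·5`, `2ᵃ3ᵇ·7`, `2ᵃ3ᵇ·35 > 630`, cell `pub-hfermat`, LIT lane), where the exceptional levels of [MeyerNeutsch1981Fermatquadrupel,
Tabelle 1] dividing the level go up to `180` (`15, 20, 30, 40, 60, 90, 120, 180` for the factor `5`; `14, 21, 28, 42, 84` for `7`).

THE CARRIED STATEMENT `StdOrLift B L`: every pair-free Hodge `4`-multiset over `ℤ/L` is STANDARD (`IsStdMultiset`: `α_x`, `β_x`,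
`γ_x` for some residue `x`) or a LIFT FROM A LEVEL `≤ B`: all members divisible by a divisor `d` of `L` with `L ≤ B·d`
(`IsLiftLe B L`). With `B = 180` this is, for the primitive quadruples of a level `L > 180`, exactly "standard", i.e. `Δ(L) = 0`
(`not_isExceptionalQuadruple_of_stdOrLift`), and conversely (`stdOrLift_of_forall_not_isExceptionalQuadruple`) it FOLLOWS from
`Δ(L′) = 0` at every divisor `L′ > 180` of `L`: a pair-free Hodge quadruple is `g·t′` with `t′` PRIMITIVE of level `L/g`
([Shioda1982PicardFermat, §2: `𝔍²_L(g) ≅ 𝔍²_{L/g}(1)`], `exists_primitive_lift`), and a primitive standard multiset is a standard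
quadruple (`isStandardQuadruple_of_isStdMultiset_of_isPrimitive'`, at EVERY level: when `2 ∥ L` resp. `3 ∥ L` the parameter `x`
of `α_x, β_x` resp. `γ_x` may fail to be a unit, but `α_x = α_{x+L/2}`, `β_x = β_{x+L/2}`, `γ_x = γ_{x+L/3} = γ_{x+2L/3}` and one
of these parameters is a unit). So the structure theorem at all levels `> 180` is equivalent to `StdOrLift 180 L` for all `L`,
and an induction on the level only ever needs `StdOrLift 180` at the lower levels — the form in which the family files of the
last levels consume their induction hypothesis (transport along `liftBy`: `isStdMultiset_map_liftBy`, `isLiftLe_map_liftBy`,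
`std_or_lift_of_forall_dvd`).

HONEST FRAMING (cell `pub-hfermat`): explicit algebraic cycles for specific Hodge classes on Fermat/Delsarte varieties; residual
open instances listed; no claim on general Hodge. (Bookkeeping for Shioda's combinatorial model of the lines on Fermat surfaces;
no cycle is constructed here.)

## References
* [Shioda1982PicardFermat] T. Shioda, *On the Picard number of a Fermat surface*, J. Fac. Sci. Univ. Tokyo IA 28 (1982)
  725–734 — §2 p. 726 (`𝔍²ₘ(d) ≅ 𝔍²_{m/d}(1)`, `GCD(α)`), Lemma 1 (a), (b) p. 728, Prop. 4 (Q′) p. 729.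
* [MeyerNeutsch1981Fermatquadrupel] W. Meyer, W. Neutsch, *Fermatquadrupel*, Math. Ann. 256 (1981) 51–62 — (9)–(15) p. 52–53,
  Tabelle 1 p. 54.
* [AokiShioda1983] N. Aoki, T. Shioda, Progr. Math. 35 (1983) 1–12 — §2 Thm. (𝔅²ₘ) (ii).
* [Aoki1983] N. Aoki, Math. Ann. 266 (1983) 23–54 — Thm. C p. 47.
-/

namespace Literature.AlgebraicGeometry.Shioda1982

open Finset Multiset
open Literature.AlgebraicGeometry.HodgeTheory Literature.AlgebraicGeometry.HodgeTheory.FermatCharacter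

/-! ## The vocabulary -/

/-- **Lift from a level `≤ B`**: all members of `s` are divisible by a divisor `d` of `L` with `L ≤ B·d` — `s = d·s′` for a
multiset `s′` of the level `L/d ≤ B` (`𝔍²_L(d) ≅ 𝔍²_{L/d}(1)`, [Shioda1982PicardFermat, §2]); `d = 1` is allowed, so at a level
`L ≤ B` every multiset qualifies. `IsSmallLift = IsLiftLe 72`; the levels of [MeyerNeutsch1981Fermatquadrupel, Tabelle 1] are
`≤ 180`. [cite: Shioda1982PicardFermat, §2 p. 726 (𝔍²ₘ(d))] [cite: MeyerNeutsch1981Fermatquadrupel, Tabelle 1 p. 54] -/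
def IsLiftLe (B L : ℕ) (s : Multiset (ZMod L)) : Prop :=
  ∃ d : ℕ, d ∣ L ∧ L ≤ B * d ∧ ∀ a ∈ s, d ∣ a.val

/-- **Standard or a lift from a level `≤ B`**: every pair-free Hodge `4`-multiset over `ℤ/L` is `α_x`, `β_x`, `γ_x` for some
residue `x`, or a lift from a level `≤ B` — the multiset form of [Shioda1982PicardFermat, Prop. 4 (Q′)] /
[AokiShioda1983, Thm. (𝔅²ₘ) (ii)] with the exceptional levels bounded by `B` (`StdOrSmall = StdOrLift 72`).
[cite: Shioda1982PicardFermat, Prop. 4 (Q′) p. 729, §2 p. 726] [cite: AokiShioda1983, Thm. (𝔅²ₘ) (ii)] -/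
def StdOrLift (B L : ℕ) : Prop :=
  ∀ t : Multiset (ZMod L), IsHodgeMultiset t → card t = 4 → ¬ HasPair t → IsStdMultiset L t ∨ IsLiftLe B L t

section Basic

variable {L B : ℕ}

/-- `IsSmallLift` is `IsLiftLe 72`. [cite: Shioda1982PicardFermat, §2 p. 726 (𝔍²ₘ(d))] -/
theorem isSmallLift_iff_isLiftLe {s : Multiset (ZMod L)} : IsSmallLift L s ↔ IsLiftLe 72 L s := Iff.rfl

/-- `StdOrSmall` is `StdOrLift 72`. [cite: Shioda1982PicardFermat, Prop. 4 (Q′) p. 729] -/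
theorem stdOrSmall_iff_stdOrLift : StdOrSmall L ↔ StdOrLift 72 L := Iff.rfl

/-- Monotonicity in the bound. [cite: Shioda1982PicardFermat, §2 p. 726 (𝔍²ₘ(d))] -/
theorem IsLiftLe.mono {B' : ℕ} {s : Multiset (ZMod L)} (h : IsLiftLe B L s) (hB : B ≤ B') : IsLiftLe B' L s := by
  obtain ⟨d, hd, hle, hds⟩ := h
  exact ⟨d, hd, le_trans hle (Nat.mul_le_mul_right d hB), hds⟩

/-- Monotonicity in the bound. [cite: Shioda1982PicardFermat, Prop. 4 (Q′) p. 729] -/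
theorem StdOrLift.mono {B' : ℕ} (h : StdOrLift B L) (hB : B ≤ B') : StdOrLift B' L :=
  fun t ht hc hpf ↦ (h t ht hc hpf).imp_right fun hl ↦ hl.mono hB

/-- `T(L) = StdOrSmall L` gives `StdOrLift 180 L`. [cite: Shioda1982PicardFermat, Prop. 4 (Q′) p. 729] -/
theorem stdOrLift_of_stdOrSmall (h : StdOrSmall L) : StdOrLift 180 L :=
  (stdOrSmall_iff_stdOrLift.mp h).mono (by norm_num)

/-- `StdOrLift B L` is void at a level `L ≤ B` (`d = 1`). [cite: MeyerNeutsch1981Fermatquadrupel, Tabelle 1 p. 54] -/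
theorem stdOrLift_of_le (hL : L ≤ B) : StdOrLift B L :=
  fun t _ _ _ ↦ Or.inr ⟨1, one_dvd L, by omega, fun a _ ↦ one_dvd _⟩

/-! ### Primitivity: the iterated `gcd` -/

/-- The iterated `gcd` divides the initial value. [folklore] -/
private theorem foldr_gcd_dvd_init (l : Multiset ℕ) (b : ℕ) : l.foldr Nat.gcd b ∣ b := by
  induction l using Multiset.induction_on with
  | empty => simp
  | cons a s ih => rw [Multiset.foldr_cons]; exact dvd_trans (Nat.gcd_dvd_right _ _) ih

/-- The iterated `gcd` divides every member. [folklore] -/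
private theorem foldr_gcd_dvd_mem (l : Multiset ℕ) (b : ℕ) {v : ℕ} (hv : v ∈ l) : l.foldr Nat.gcd b ∣ v := by
  induction l using Multiset.induction_on with
  | empty => exact absurd hv (Multiset.notMem_zero v)
  | cons a s ih =>
    rw [Multiset.foldr_cons]
    rcases Multiset.mem_cons.mp hv with rfl | hv'
    · exact Nat.gcd_dvd_left _ _
    · exact dvd_trans (Nat.gcd_dvd_right _ _) (ih hv')

/-- A common divisor of the members and of the initial value divides the iterated `gcd`. [folklore] -/
private theorem dvd_foldr_gcd (l : Multiset ℕ) {b d : ℕ} (hb : d ∣ b) (hl : ∀ v ∈ l, d ∣ v) : d ∣ l.foldr Nat.gcd b := by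
  induction l using Multiset.induction_on with
  | empty => simpa using hb
  | cons a s ih =>
    rw [Multiset.foldr_cons]
    exact Nat.dvd_gcd (hl a (Multiset.mem_cons_self a s)) (ih fun v hv ↦ hl v (Multiset.mem_cons_of_mem hv))

/-- **A lift from a level `≤ B` at a level `L > B` is imprimitive.** [cite: MeyerNeutsch1981Fermatquadrupel, (9)–(10) p. 52]
[cite: Shioda1982PicardFermat, §2 p. 726 (𝔍²ₘ(d))] -/
theorem not_isPrimitive_of_isLiftLe (hL : B < L) {s : Multiset (ZMod L)} (hs : IsLiftLe B L s) : ¬ IsPrimitive L s := by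
  rintro hprim
  obtain ⟨d, hdL, hle, hds⟩ := hs
  have hd : d ∣ (s.map ZMod.val).foldr Nat.gcd L :=
    dvd_foldr_gcd _ hdL fun v hv ↦ by
      obtain ⟨a, ha, rfl⟩ := Multiset.mem_map.mp hv
      exact hds a ha
  rw [hprim, Nat.dvd_one] at hd
  subst hd
  omega

/-- A prime dividing the level and the representatives of all members witnesses imprimitivity.
[cite: Shioda1982PicardFermat, §2 p. 726 (GCD(α))] -/
theorem not_isPrimitive_of_prime_dvd {p : ℕ} (hp : p.Prime) (hpL : p ∣ L) {s : Multiset (ZMod L)}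
    (h : ∀ a ∈ s, p ∣ a.val) : ¬ IsPrimitive L s := by
  intro hprim
  have hd : p ∣ (s.map ZMod.val).foldr Nat.gcd L :=
    dvd_foldr_gcd _ hpL fun v hv ↦ by
      obtain ⟨a, ha, rfl⟩ := Multiset.mem_map.mp hv
      exact h a ha
  rw [hprim, Nat.dvd_one] at hd
  exact hp.one_lt.ne' hd

/-- Conversely, an imprimitive multiset has a prime dividing the level and all representatives (`L > 1`).
[cite: Shioda1982PicardFermat, §2 p. 726 (GCD(α))] -/
theorem exists_prime_dvd_of_not_isPrimitive [NeZero L] {s : Multiset (ZMod L)} (h : ¬ IsPrimitive L s) :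
    ∃ p : ℕ, p.Prime ∧ p ∣ L ∧ ∀ a ∈ s, p ∣ a.val := by
  set g := (s.map ZMod.val).foldr Nat.gcd L with hg
  obtain ⟨p, hp, hpg⟩ := Nat.exists_prime_and_dvd (show g ≠ 1 from h)
  exact ⟨p, hp, dvd_trans hpg (foldr_gcd_dvd_init _ _),
    fun a ha ↦ dvd_trans hpg (foldr_gcd_dvd_mem _ _ (Multiset.mem_map_of_mem _ ha))⟩

end Basic

/-! ## Transport along `liftBy : ℤ/n → ℤ/m`, `m = n·d` -/

section Lift

variable {m n d : ℕ} [NeZero m] [NeZero n]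

/-- `⟨liftBy k⟩ = ⟨k⟩ d`. [cite: Shioda1982PicardFermat, §2 p. 726 (𝔍²ₘ(d))] -/
theorem val_liftBy' (hm : m = n * d) (k : ZMod n) : (liftBy m n d k).val = k.val * d := by
  rw [liftBy, ZMod.val_natCast, Nat.mod_eq_of_lt (by rw [hm]; have := ZMod.val_lt k; have := NeZero.pos m; nlinarith)]

/-- `liftBy` is injective (`d > 0`). [cite: Shioda1982PicardFermat, §2 p. 726 (𝔍²ₘ(d))] -/
theorem liftBy_injective' (hm : m = n * d) (hd : 0 < d) : Function.Injective (liftBy m n d) := by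
  intro a b h
  have := congrArg ZMod.val h
  rw [val_liftBy' hm, val_liftBy' hm] at this
  exact ZMod.val_injective n (Nat.eq_of_mul_eq_mul_right hd this)

omit [NeZero m] in
/-- `liftBy` is additive. [cite: Shioda1982PicardFermat, §2 p. 726 (𝔍²ₘ(d))] -/
theorem liftBy_add' (hm : m = n * d) (a b : ZMod n) : liftBy m n d (a + b) = liftBy m n d a + liftBy m n d b := by
  rw [liftBy, liftBy, liftBy, ← Nat.cast_add, ZMod.natCast_eq_natCast_iff, hm, ZMod.val_add, ← Nat.add_mul,
    ← Nat.mul_mod_mul_right]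
  exact Nat.mod_modEq _ _

omit [NeZero m] [NeZero n] in
/-- `liftBy 0 = 0`. [cite: Shioda1982PicardFermat, §2 p. 726 (𝔍²ₘ(d))] -/
theorem liftBy_zero' : liftBy m n d 0 = 0 := by
  simp [liftBy]

omit [NeZero m] in
/-- `liftBy (−a) = −liftBy a`. [cite: Shioda1982PicardFermat, §2 p. 726 (𝔍²ₘ(d))] -/
theorem liftBy_neg' (hm : m = n * d) (a : ZMod n) : liftBy m n d (-a) = -liftBy m n d a := by
  have h : liftBy m n d (-a) + liftBy m n d a = 0 := by rw [← liftBy_add' hm, neg_add_cancel, liftBy_zero']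
  exact eq_neg_of_add_eq_zero_left h

omit [NeZero m] in
/-- `liftBy (2a) = 2·liftBy a`. [cite: Shioda1982PicardFermat, §2 p. 726 (𝔍²ₘ(d))] -/
theorem liftBy_two_mul' (hm : m = n * d) (a : ZMod n) : liftBy m n d (2 * a) = 2 * liftBy m n d a := by
  rw [two_mul, two_mul, liftBy_add' hm]

omit [NeZero m] in
/-- `liftBy (3a) = 3·liftBy a`. [folklore] -/
private theorem liftBy_three_mul (hm : m = n * d) (a : ZMod n) : liftBy m n d (3 * a) = 3 * liftBy m n d a := by
  rw [show (3 : ZMod n) * a = 2 * a + a by ring, liftBy_add' hm, liftBy_two_mul' hm]; ring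

omit [NeZero m] in
/-- `liftBy (4a) = 4·liftBy a`. [folklore] -/
private theorem liftBy_four_mul (hm : m = n * d) (a : ZMod n) : liftBy m n d (4 * a) = 4 * liftBy m n d a := by
  rw [show (4 : ZMod n) * a = 2 * a + 2 * a by ring, liftBy_add' hm, liftBy_two_mul' hm]; ring

omit [NeZero n] in
/-- Every residue in `dℤ/m` is a lift. [cite: Shioda1982PicardFermat, §2 p. 726 (𝔍²ₘ(d))] -/
theorem liftBy_div' (hm : m = n * d) (hd : 0 < d) {w : ZMod m} (hw : d ∣ w.val) :
    liftBy m n d ((w.val / d : ℕ) : ZMod n) = w := by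
  have hlt : w.val / d < n := by
    rw [Nat.div_lt_iff_lt_mul hd]; exact lt_of_lt_of_eq (ZMod.val_lt w) hm
  rw [liftBy, ZMod.val_natCast, Nat.mod_eq_of_lt hlt, Nat.div_mul_cancel hw, ZMod.natCast_zmod_val]

omit [NeZero m] in
/-- `liftBy (n/2) = m/2` (`2 ∣ n`). [cite: Shioda1982PicardFermat, §2 p. 726 (𝔍²ₘ(d)), Lemma 1 (a) p. 728] -/
theorem liftBy_half' (hm : m = n * d) (h2 : 2 ∣ n) : liftBy m n d ((n / 2 : ℕ) : ZMod n) = ((m / 2 : ℕ) : ZMod m) := by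
  obtain ⟨K, hK⟩ := h2
  have hn2 : n / 2 = K := by rw [hK, Nat.mul_div_cancel_left _ two_pos]
  have hm2 : m / 2 = K * d := by rw [hm, hK, mul_assoc, Nat.mul_div_cancel_left _ two_pos]
  rw [liftBy, hn2, hm2, ZMod.val_natCast, Nat.mod_eq_of_lt (by have := NeZero.pos n; omega)]

omit [NeZero m] in
/-- `liftBy (n/3) = m/3` (`3 ∣ n`). [cite: Shioda1982PicardFermat, §2 p. 726 (𝔍²ₘ(d)), Lemma 1 (b) p. 728] -/
theorem liftBy_third' (hm : m = n * d) (h3 : 3 ∣ n) :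
    liftBy m n d ((n / 3 : ℕ) : ZMod n) = ((m / 3 : ℕ) : ZMod m) := by
  obtain ⟨R, hR⟩ := h3
  have hn3 : n / 3 = R := by rw [hR, Nat.mul_div_cancel_left _ three_pos]
  have hm3 : m / 3 = R * d := by rw [hm, hR, mul_assoc, Nat.mul_div_cancel_left _ three_pos]
  rw [liftBy, hn3, hm3, ZMod.val_natCast, Nat.mod_eq_of_lt (by have := NeZero.pos n; omega)]

omit [NeZero m] in
/-- **Standard multisets lift to standard multisets**: `d·α_{x′} = α_{d x′}`, `d·β_{x′} = β_{d x′}`, `d·γ_{x′} = γ_{d x′}`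
(`𝔍²ₘ(d) ≅ 𝔍²_{m/d}(1)`, [Shioda1982PicardFermat, §2 p. 726]; the parity of the lower level `n` carries `2 ∣ m`, `3 ∣ m`).
[cite: Shioda1982PicardFermat, §2 p. 726, Lemma 1 (a), (b) p. 728] -/
theorem isStdMultiset_map_liftBy (hm : m = n * d) {t : Multiset (ZMod n)} (ht : IsStdMultiset n t) :
    IsStdMultiset m (t.map (liftBy m n d)) := by
  obtain ⟨x, ⟨h2, hx⟩ | ⟨h3, hx⟩⟩ := ht
  · have h2m : 2 ∣ m := dvd_trans h2 ⟨d, hm⟩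
    refine ⟨liftBy m n d x, Or.inl ⟨h2m, ?_⟩⟩
    rcases hx with rfl | rfl
    · left
      simp only [Multiset.insert_eq_cons, Multiset.map_cons, Multiset.map_singleton, liftBy_add' hm, liftBy_neg' hm,
        liftBy_two_mul' hm, liftBy_half' hm h2]
    · right
      simp only [Multiset.insert_eq_cons, Multiset.map_cons, Multiset.map_singleton, liftBy_add' hm, liftBy_neg' hm,
        liftBy_two_mul' hm, liftBy_four_mul hm, liftBy_half' hm h2]
  · have h3m : 3 ∣ m := dvd_trans h3 ⟨d, hm⟩
    refine ⟨liftBy m n d x, Or.inr ⟨h3m, ?_⟩⟩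
    rw [hx]
    simp only [Multiset.insert_eq_cons, Multiset.map_cons, Multiset.map_singleton, liftBy_add' hm, liftBy_neg' hm,
      liftBy_two_mul' hm, liftBy_three_mul hm, liftBy_third' hm h3]

/-- **Lifts from a level `≤ B` lift to lifts from a level `≤ B`.** [cite: Shioda1982PicardFermat, §2 p. 726 (𝔍²ₘ(d))] -/
theorem isLiftLe_map_liftBy {B : ℕ} (hm : m = n * d) {t : Multiset (ZMod n)} (ht : IsLiftLe B n t) :
    IsLiftLe B m (t.map (liftBy m n d)) := by
  obtain ⟨d', hd', hle, hds⟩ := ht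
  refine ⟨d' * d, ⟨n / d', ?_⟩, ?_, fun a ha ↦ ?_⟩
  · obtain ⟨c, hc⟩ := hd'
    have hd'0 : 0 < d' := Nat.pos_of_ne_zero fun h ↦ by rw [h, zero_mul] at hc; exact NeZero.ne n hc
    rw [hc, Nat.mul_div_cancel_left _ hd'0, hm, hc]; ring
  · rw [hm]; nlinarith
  · obtain ⟨a', ha', rfl⟩ := Multiset.mem_map.mp ha
    rw [val_liftBy' hm]
    exact Nat.mul_dvd_mul (hds a' ha') (dvd_refl d)

omit [NeZero m] in
/-- A pair in `t` lifts to a pair in `d·t`. [cite: Shioda1982PicardFermat, §2 p. 726] -/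
theorem hasPair_map_liftBy (hm : m = n * d) {t : Multiset (ZMod n)} (ht : HasPair t) : HasPair (t.map (liftBy m n d)) := by
  classical
  obtain ⟨a, ha, hna⟩ := ht
  refine ⟨liftBy m n d a, Multiset.mem_map_of_mem _ ha, ?_⟩
  rw [← Multiset.map_erase_of_mem _ _ ha, ← liftBy_neg' hm]
  exact Multiset.mem_map_of_mem _ hna

/-- **Every multiset is the lift of a PRIMITIVE multiset**: with `g = GCD` of the representatives and the level, `L = n·g` and
`s = g·t` for a primitive `t` of level `n` (`𝔍²_L = ⨆_d 𝔍²_L(d)`, `𝔍²_L(d) ≅ 𝔍²_{L/d}(1)`, [Shioda1982PicardFermat, §2]).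
[cite: Shioda1982PicardFermat, §2 p. 726] [cite: MeyerNeutsch1981Fermatquadrupel, (9)–(10) p. 52] -/
theorem exists_primitive_lift {L : ℕ} [NeZero L] (s : Multiset (ZMod L)) :
    ∃ n g : ℕ, ∃ _ : NeZero n, L = n * g ∧ 0 < g ∧ ∃ t : Multiset (ZMod n),
      s = t.map (liftBy L n g) ∧ card t = card s ∧ IsPrimitive n t ∧ ∀ a ∈ t, g ∣ (liftBy L n g a).val := by
  classical
  set g := (s.map ZMod.val).foldr Nat.gcd L with hg
  have hgL : g ∣ L := foldr_gcd_dvd_init _ _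
  obtain ⟨n, hn⟩ := hgL
  have hL0 := NeZero.pos L
  have hg0 : 0 < g := Nat.pos_of_ne_zero fun h ↦ by rw [h, zero_mul] at hn; omega
  have hn0 : 0 < n := Nat.pos_of_ne_zero fun h ↦ by rw [h, mul_zero] at hn; omega
  haveI : NeZero n := ⟨by omega⟩
  have hLn : L = n * g := by rw [hn, mul_comm]
  have hmem : ∀ w ∈ s, g ∣ w.val := fun w hw ↦ foldr_gcd_dvd_mem _ _ (Multiset.mem_map_of_mem _ hw)
  set f : ZMod L → ZMod n := fun w ↦ ((w.val / g : ℕ) : ZMod n) with hf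
  have hga : ∀ w ∈ s, liftBy L n g (f w) = w := fun w hw ↦ liftBy_div' hLn hg0 (hmem w hw)
  refine ⟨n, g, inferInstance, hLn, hg0, s.map f, ?_, by rw [Multiset.card_map], ?_, fun a _ ↦ ?_⟩
  · rw [Multiset.map_map]
    conv_lhs => rw [← Multiset.map_id s]
    exact Multiset.map_congr rfl fun w hw ↦ (hga w hw).symm
  · -- primitivity of the quotient
    unfold IsPrimitive
    set G := ((s.map f).map ZMod.val).foldr Nat.gcd n with hG
    have hGn : G ∣ n := foldr_gcd_dvd_init _ _
    have hGv : ∀ w ∈ s, G ∣ w.val / g := fun w hw ↦ by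
      have h1 : G ∣ (f w).val := foldr_gcd_dvd_mem _ _ (Multiset.mem_map_of_mem _ (Multiset.mem_map_of_mem _ hw))
      have hlt : w.val / g < n := by
        rw [Nat.div_lt_iff_lt_mul hg0]; exact lt_of_lt_of_eq (ZMod.val_lt w) hLn
      rwa [hf, ZMod.val_natCast, Nat.mod_eq_of_lt hlt] at h1
    have hGg : G * g ∣ g := by
      show G * g ∣ (s.map ZMod.val).foldr Nat.gcd L
      refine dvd_foldr_gcd _ (by rw [hLn]; exact Nat.mul_dvd_mul hGn (dvd_refl g)) fun v hv ↦ ?_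
      obtain ⟨w, hw, rfl⟩ := Multiset.mem_map.mp hv
      have := Nat.mul_dvd_mul (hGv w hw) (dvd_refl g)
      rwa [Nat.div_mul_cancel (hmem w hw)] at this
    have : G * g ≤ 1 * g := by rw [one_mul]; exact Nat.le_of_dvd hg0 hGg
    have hG1 : G ≤ 1 := Nat.le_of_mul_le_mul_right this hg0
    have hG0 : G ≠ 0 := fun h ↦ by rw [h, zero_dvd_iff] at hGn; omega
    omega
  · rw [val_liftBy' hLn]; exact Dvd.intro_left _ rfl

/-- **A pair-free Hodge quadruple all of whose members are divisible by `d` (`m = n·d`) is governed by the level `n`**: if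
`StdOrLift B n`, then it is standard or a lift from a level `≤ B`. [cite: Shioda1982PicardFermat, §2 p. 726 (𝔍²ₘ(d) ≅ 𝔍²_{m/d}(1)), Prop. 4 (Q′) p. 729] -/
theorem std_or_lift_of_forall_dvd {B : ℕ} (hm : m = n * d) (hd : 0 < d) (IH : StdOrLift B n) {s : Multiset (ZMod m)}
    (hs : IsHodgeMultiset s) (hc : card s = 4) (hpf : ¬ HasPair s) (hdvd : ∀ w ∈ s, d ∣ w.val) :
    IsStdMultiset m s ∨ IsLiftLe B m s := by
  classical
  set f : ZMod m → ZMod n := fun w ↦ ((w.val / d : ℕ) : ZMod n) with hf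
  have hga : ∀ w ∈ s, liftBy m n d (f w) = w := fun w hw ↦ liftBy_div' hm hd (hdvd w hw)
  have hs' : s = (s.map f).map (liftBy m n d) := by
    rw [Multiset.map_map]
    conv_lhs => rw [← Multiset.map_id s]
    exact Multiset.map_congr rfl fun w hw ↦ (hga w hw).symm
  have ht : IsHodgeMultiset (s.map f) := by
    rw [hs', isHodgeMultiset_map_liftBy_iff hm hd] at hs; exact hs
  have htc : card (s.map f) = 4 := by rw [Multiset.card_map, hc]
  have htpf : ¬ HasPair (s.map f) := fun h ↦ hpf (by rw [hs']; exact hasPair_map_liftBy hm h)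
  rcases IH _ ht htc htpf with h | h
  · left; rw [hs']; exact isStdMultiset_map_liftBy hm h
  · right; rw [hs']; exact isLiftLe_map_liftBy hm h

end Lift

/-! ## A primitive standard multiset is a standard quadruple — at every level -/

section PrimitiveStandard

variable {L : ℕ} [NeZero L]

/-- `p ∣ ⟨x + c⟩` when `p ∣ L`, `p ∣ ⟨x⟩`, `p ∣ ⟨c⟩`. [folklore] -/
private theorem dvd_val_add {p : ℕ} (hp : p ∣ L) {x c : ZMod L} (hx : p ∣ x.val) (hc : p ∣ c.val) : p ∣ (x + c).val := by
  rw [ZMod.val_add]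
  exact (Nat.dvd_mod_iff hp).mpr (Nat.dvd_add hx hc)

/-- `p ∣ ⟨−x⟩` when `p ∣ L`, `p ∣ ⟨x⟩`. [folklore] -/
private theorem dvd_val_neg {p : ℕ} (hp : p ∣ L) {x : ZMod L} (hx : p ∣ x.val) : p ∣ (-x).val := by
  rw [ZMod.neg_val]
  split_ifs
  · exact dvd_zero p
  · exact Nat.dvd_sub hp hx

omit [NeZero L] in
/-- `p ∣ ⟨c·x⟩` when `p ∣ L`, `p ∣ ⟨x⟩`. [folklore] -/
private theorem dvd_val_mul {p : ℕ} (hp : p ∣ L) (c : ZMod L) {x : ZMod L} (hx : p ∣ x.val) : p ∣ (c * x).val := by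
  rw [ZMod.val_mul]
  exact (Nat.dvd_mod_iff hp).mpr (Dvd.dvd.mul_left hx _)

omit [NeZero L] in
/-- `p ∣ ⟨(L/q : ℕ)⟩` for a prime `p ∣ L` different from the prime `q` (`q ∣ L`). [folklore] -/
private theorem dvd_val_quot {p q : ℕ} (hp : p.Prime) (hq : q.Prime) (hpL : p ∣ L) (hqL : q ∣ L) (hpq : p ≠ q) :
    p ∣ (((L / q : ℕ)) : ZMod L).val := by
  obtain ⟨c, hc⟩ := hqL
  have hLq : L / q = c := by rw [hc, Nat.mul_div_cancel_left _ hq.pos]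
  rw [hLq, ZMod.val_natCast]
  refine (Nat.dvd_mod_iff hpL).mpr ?_
  rcases (Nat.Prime.dvd_mul hp).mp (hc ▸ hpL) with h | h
  · exact absurd ((Nat.prime_dvd_prime_iff_eq hp hq).mp h) hpq
  · exact h

omit [NeZero L] in
/-- `p ∣ ⟨(L/p : ℕ)⟩` when `p² ∣ L`. [folklore] -/
private theorem dvd_val_quot_self {p : ℕ} (hp : p.Prime) (hpp : p * p ∣ L) :
    p ∣ (((L / p : ℕ)) : ZMod L).val := by
  obtain ⟨c, hc⟩ := hpp
  have hLp : L / p = p * c := by rw [hc, mul_assoc, Nat.mul_div_cancel_left _ hp.pos]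
  rw [hLp, ZMod.val_natCast]
  exact (Nat.dvd_mod_iff (hc ▸ ⟨p * c, by ring⟩)).mpr (Dvd.intro c rfl)

omit [NeZero L] in
/-- Coprimality from the absence of common prime factors. [folklore] -/
private theorem coprime_of_forall_prime {a : ℕ} (h : ∀ p : ℕ, p.Prime → p ∣ L → ¬ p ∣ a) : Nat.Coprime a L := by
  rw [Nat.coprime_iff_gcd_eq_one]
  by_contra hg
  obtain ⟨p, hp, hpg⟩ := Nat.exists_prime_and_dvd hg
  exact h p hp (dvd_trans hpg (Nat.gcd_dvd_right _ _)) (dvd_trans hpg (Nat.gcd_dvd_left _ _))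

omit [NeZero L] in
/-- `2K = 0` at level `L = 2K`. [folklore] -/
private theorem two_mul_half {K : ℕ} (hL : L = 2 * K) : (2 : ZMod L) * ((K : ℕ) : ZMod L) = 0 := by
  rw [show (2 : ZMod L) * ((K : ℕ) : ZMod L) = ((L : ℕ) : ZMod L) by rw [hL]; push_cast; ring, ZMod.natCast_self]

omit [NeZero L] in
/-- `3R = 0` at level `L = 3R`. [folklore] -/
private theorem three_mul_third {R : ℕ} (hL : L = 3 * R) : (3 : ZMod L) * ((R : ℕ) : ZMod L) = 0 := by
  rw [show (3 : ZMod L) * ((R : ℕ) : ZMod L) = ((L : ℕ) : ZMod L) by rw [hL]; push_cast; ring, ZMod.natCast_self]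

/-- The standard multiset with a unit parameter is a standard quadruple. [cite: MeyerNeutsch1981Fermatquadrupel, (13)–(15) p. 53] -/
private theorem isStandardQuadruple_of_coprime {s : Multiset (ZMod L)} {x : ZMod L} (hcop : Nat.Coprime x.val L)
    (hx : (2 ∣ L ∧ (s = {x, x + ((L / 2 : ℕ) : ZMod L), -(2 * x), ((L / 2 : ℕ) : ZMod L)} ∨
      s = {x, x + ((L / 2 : ℕ) : ZMod L), 2 * x + ((L / 2 : ℕ) : ZMod L), -(4 * x)})) ∨
      (3 ∣ L ∧ s = {x, x + ((L / 3 : ℕ) : ZMod L), x + 2 * ((L / 3 : ℕ) : ZMod L), -(3 * x)})) :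
    IsStandardQuadruple L s := by
  set t := ZMod.unitOfCoprime x.val hcop with ht
  have htx : (t : ZMod L) = x := by rw [ht, ZMod.coe_unitOfCoprime, ZMod.natCast_zmod_val]
  rcases hx with ⟨h2, h | h⟩ | ⟨h3, h⟩
  · obtain ⟨K, hK⟩ := h2
    have hK' : L / 2 = K := by rw [hK, Nat.mul_div_cancel_left _ two_pos]
    refine ⟨t, Or.inl ⟨⟨K, hK⟩, Or.inl ?_⟩⟩
    rw [map_unit_stdOne hK, htx, h, hK']
  · obtain ⟨K, hK⟩ := h2
    have hK' : L / 2 = K := by rw [hK, Nat.mul_div_cancel_left _ two_pos]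
    refine ⟨t, Or.inl ⟨⟨K, hK⟩, Or.inr ?_⟩⟩
    rw [map_unit_stdTwo hK, htx, h, hK']
  · obtain ⟨R, hR⟩ := h3
    have hR' : L / 3 = R := by rw [hR, Nat.mul_div_cancel_left _ three_pos]
    refine ⟨t, Or.inr ⟨⟨R, hR⟩, ?_⟩⟩
    rw [map_unit_stdThree hR, htx, h, hR']

/-- **A primitive standard multiset is a standard quadruple, at every level.** If `s = α_x`, `β_x` (`2 ∣ L`) or `γ_x` (`3 ∣ L`)
has no common divisor with the level, then `s` is a unit multiple of Meyer–Neutsch's `L₁`, `L₂`, `L₃`: an odd prime (resp. a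
prime `≠ 3`) dividing `x` and `L` divides every member, and so does `2` when `4 ∣ L` (resp. `3` when `9 ∣ L`); when `2 ∥ L`
(resp. `3 ∥ L`) the parameter can be moved to `x + L/2` (`α_{x+L/2} = α_x`, `β_{x+L/2} = β_x`) resp. `x + L/3`, `x + 2L/3`
(`γ` is cyclic in its first three entries), one of which is prime to `L`. (`StandardQuadrupleTwoThreePower` has the case
`4 ∣ L`, `9 ∣ L`.) [cite: Shioda1982PicardFermat, §2 p. 726 (GCD(α) = 1), Lemma 1 (a), (b) p. 728]
[cite: MeyerNeutsch1981Fermatquadrupel, (13)–(15) p. 53] -/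
theorem isStandardQuadruple_of_isStdMultiset_of_isPrimitive' {s : Multiset (ZMod L)} (hstd : IsStdMultiset L s)
    (hprim : IsPrimitive L s) : IsStandardQuadruple L s := by
  classical
  obtain ⟨x, hx⟩ := hstd
  -- no prime of `L` other than `2` (types `α, β`) resp. `3` (type `γ`) divides `x`
  rcases hx with ⟨h2, hx⟩ | ⟨h3, hx⟩
  · obtain ⟨K, hK⟩ := h2
    have hK' : L / 2 = K := by rw [hK, Nat.mul_div_cancel_left _ two_pos]
    rw [hK'] at hx
    have hKK : ((K : ℕ) : ZMod L) + ((K : ℕ) : ZMod L) = 0 := by rw [← two_mul]; exact two_mul_half hK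
    -- an odd prime of `L` dividing `⟨y⟩` for `y ∈ {x, x + K}` divides all members
    have hodd : ∀ p : ℕ, p.Prime → p ∣ L → p ≠ 2 → ¬ p ∣ x.val := by
      intro p hp hpL hp2 hpx
      have hpK : p ∣ ((K : ℕ) : ZMod L).val := hK' ▸ dvd_val_quot hp Nat.prime_two hpL ⟨K, hK⟩ hp2
      apply not_isPrimitive_of_prime_dvd hp hpL (s := s) _ hprim
      intro a ha
      rcases hx with rfl | rfl <;> simp only [Multiset.insert_eq_cons, Multiset.mem_cons, Multiset.mem_singleton] at ha <;>
        rcases ha with rfl | rfl | rfl | rfl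
      · exact hpx
      · exact dvd_val_add hpL hpx hpK
      · exact dvd_val_neg hpL (dvd_val_mul hpL 2 hpx)
      · exact hpK
      · exact hpx
      · exact dvd_val_add hpL hpx hpK
      · exact dvd_val_add hpL (dvd_val_mul hpL 2 hpx) hpK
      · exact dvd_val_neg hpL (dvd_val_mul hpL 4 hpx)
    have hodd' : ∀ p : ℕ, p.Prime → p ∣ L → p ≠ 2 → ¬ p ∣ (x + ((K : ℕ) : ZMod L)).val := by
      intro p hp hpL hp2 hpx
      have hpK : p ∣ ((K : ℕ) : ZMod L).val := hK' ▸ dvd_val_quot hp Nat.prime_two hpL ⟨K, hK⟩ hp2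
      apply hodd p hp hpL hp2
      have := dvd_val_add hpL hpx (dvd_val_neg hpL hpK)
      rwa [add_neg_cancel_right] at this
    -- the parameter `x` or `x + K` is prime to `L`
    have hpar : Nat.Coprime x.val L ∨ Nat.Coprime (x + ((K : ℕ) : ZMod L)).val L := by
      by_cases h2x : 2 ∣ x.val
      · -- then `2 ∤ K` (else everything is even) and `x + K` is odd
        have hK2 : ¬ 2 ∣ K := by
          intro hK2
          have h4 : 2 * 2 ∣ L := by obtain ⟨c, hc⟩ := hK2; exact ⟨c, by rw [hK, hc]; ring⟩
          have h2K : 2 ∣ ((K : ℕ) : ZMod L).val := hK' ▸ dvd_val_quot_self Nat.prime_two h4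
          apply not_isPrimitive_of_prime_dvd Nat.prime_two ⟨K, hK⟩ (s := s) _ hprim
          intro a ha
          rcases hx with rfl | rfl <;> simp only [Multiset.insert_eq_cons, Multiset.mem_cons, Multiset.mem_singleton] at ha <;>
            rcases ha with rfl | rfl | rfl | rfl
          · exact h2x
          · exact dvd_val_add ⟨K, hK⟩ h2x h2K
          · exact dvd_val_neg ⟨K, hK⟩ (dvd_val_mul ⟨K, hK⟩ 2 h2x)
          · exact h2K
          · exact h2x
          · exact dvd_val_add ⟨K, hK⟩ h2x h2K
          · exact dvd_val_add ⟨K, hK⟩ (dvd_val_mul ⟨K, hK⟩ 2 h2x) h2K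
          · exact dvd_val_neg ⟨K, hK⟩ (dvd_val_mul ⟨K, hK⟩ 4 h2x)
        right
        refine coprime_of_forall_prime fun p hp hpL ↦ ?_
        by_cases hp2 : p = 2
        · subst hp2
          intro h
          have hKval : ((K : ℕ) : ZMod L).val = K := by
            rw [ZMod.val_natCast, Nat.mod_eq_of_lt (by have := NeZero.pos L; omega)]
          rw [ZMod.val_add, hKval] at h
          have h' : 2 ∣ x.val + K := (Nat.dvd_mod_iff ⟨K, hK⟩).mp h
          exact hK2 ((Nat.dvd_add_right h2x).mp h')
        · exact hodd' p hp hpL hp2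
      · left
        refine coprime_of_forall_prime fun p hp hpL ↦ ?_
        by_cases hp2 : p = 2
        · subst hp2; exact h2x
        · exact hodd p hp hpL hp2
    rcases hpar with hcop | hcop
    · exact isStandardQuadruple_of_coprime hcop (Or.inl ⟨⟨K, hK⟩, by rw [hK']; exact hx⟩)
    · -- move the parameter to `x + K`
      refine isStandardQuadruple_of_coprime hcop (Or.inl ⟨⟨K, hK⟩, ?_⟩)
      rw [hK']
      rcases hx with rfl | rfl
      · left
        rw [show x + ((K : ℕ) : ZMod L) + ((K : ℕ) : ZMod L) = x by linear_combination hKK,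
          show -(2 * (x + ((K : ℕ) : ZMod L))) = -(2 * x) by linear_combination (-1 : ZMod L) * hKK]
        simp only [Multiset.insert_eq_cons, ← Multiset.singleton_add]
        abel
      · right
        rw [show x + ((K : ℕ) : ZMod L) + ((K : ℕ) : ZMod L) = x by linear_combination hKK,
          show 2 * (x + ((K : ℕ) : ZMod L)) + ((K : ℕ) : ZMod L) = 2 * x + ((K : ℕ) : ZMod L) by linear_combination hKK,
          show -(4 * (x + ((K : ℕ) : ZMod L))) = -(4 * x) by linear_combination (-2 : ZMod L) * hKK]
        simp only [Multiset.insert_eq_cons, ← Multiset.singleton_add]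
        abel
  · obtain ⟨R, hR⟩ := h3
    have hR' : L / 3 = R := by rw [hR, Nat.mul_div_cancel_left _ three_pos]
    rw [hR'] at hx
    have hRRR : (3 : ZMod L) * ((R : ℕ) : ZMod L) = 0 := three_mul_third hR
    -- a prime `≠ 3` of `L` dividing `⟨x + jR⟩` divides all members
    have hne3 : ∀ p : ℕ, p.Prime → p ∣ L → p ≠ 3 → ∀ j : ℕ, ¬ p ∣ (x + (j : ZMod L) * ((R : ℕ) : ZMod L)).val := by
      intro p hp hpL hp3 j hpx
      have hpR : p ∣ ((R : ℕ) : ZMod L).val := hR' ▸ dvd_val_quot hp Nat.prime_three hpL ⟨R, hR⟩ hp3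
      have hpx' : p ∣ x.val := by
        have := dvd_val_add hpL hpx (dvd_val_neg hpL (dvd_val_mul hpL (j : ZMod L) hpR))
        rwa [add_neg_cancel_right] at this
      apply not_isPrimitive_of_prime_dvd hp hpL (s := s) _ hprim
      intro a ha
      rw [hx] at ha
      simp only [Multiset.insert_eq_cons, Multiset.mem_cons, Multiset.mem_singleton] at ha
      rcases ha with rfl | rfl | rfl | rfl
      · exact hpx'
      · exact dvd_val_add hpL hpx' hpR
      · exact dvd_val_add hpL hpx' (dvd_val_mul hpL 2 hpR)
      · exact dvd_val_neg hpL (dvd_val_mul hpL 3 hpx')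
    -- the residue of `R` mod `3`, and `2 ∤ x` when `2 ∣ L` is contained in `hne3`; find `j` with `3 ∤ ⟨x + jR⟩`
    have hj : ∃ j : ℕ, j < 3 ∧ ¬ 3 ∣ (x + (j : ZMod L) * ((R : ℕ) : ZMod L)).val := by
      by_cases h3x : 3 ∣ x.val
      · -- then `3 ∤ R` (else everything is divisible by `3`)
        have hR3 : ¬ 3 ∣ R := by
          intro hR3
          have h9 : 3 * 3 ∣ L := by obtain ⟨c, hc⟩ := hR3; exact ⟨c, by rw [hR, hc]; ring⟩
          have h3R : 3 ∣ ((R : ℕ) : ZMod L).val := hR' ▸ dvd_val_quot_self Nat.prime_three h9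
          apply not_isPrimitive_of_prime_dvd Nat.prime_three ⟨R, hR⟩ (s := s) _ hprim
          intro a ha
          rw [hx] at ha
          simp only [Multiset.insert_eq_cons, Multiset.mem_cons, Multiset.mem_singleton] at ha
          rcases ha with rfl | rfl | rfl | rfl
          · exact h3x
          · exact dvd_val_add ⟨R, hR⟩ h3x h3R
          · exact dvd_val_add ⟨R, hR⟩ h3x (dvd_val_mul ⟨R, hR⟩ 2 h3R)
          · exact dvd_val_neg ⟨R, hR⟩ (dvd_val_mul ⟨R, hR⟩ 3 h3x)
        -- `⟨x + jR⟩ ≡ ⟨x⟩ + jR (mod 3)`; choose `j ∈ {1, 2}` with `jR ≢ 0`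
        have hRval : ((R : ℕ) : ZMod L).val = R := by
          rw [ZMod.val_natCast, Nat.mod_eq_of_lt (by have := NeZero.pos L; omega)]
        have hmod : ∀ j : ℕ, j < 3 → (x + (j : ZMod L) * ((R : ℕ) : ZMod L)).val % 3 = (x.val + j * R) % 3 := by
          intro j hj
          have e : x + (j : ZMod L) * ((R : ℕ) : ZMod L) = (((x.val + j * R : ℕ)) : ZMod L) := by
            push_cast; rw [ZMod.natCast_zmod_val]
          rw [e, ZMod.val_natCast, Nat.mod_mod_of_dvd _ ⟨R, hR⟩]
        have hx0 : x.val % 3 = 0 := Nat.mod_eq_zero_of_dvd h3x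
        have hR12 : R % 3 = 1 ∨ R % 3 = 2 := by omega
        rcases hR12 with h | h
        · refine ⟨1, by norm_num, fun hd ↦ ?_⟩
          have := Nat.mod_eq_zero_of_dvd hd
          rw [hmod 1 (by norm_num)] at this
          omega
        · refine ⟨1, by norm_num, fun hd ↦ ?_⟩
          have := Nat.mod_eq_zero_of_dvd hd
          rw [hmod 1 (by norm_num)] at this
          omega
      · exact ⟨0, by norm_num, by simpa using h3x⟩
    obtain ⟨j, hj3, hj⟩ := hj
    set x' := x + (j : ZMod L) * ((R : ℕ) : ZMod L) with hx'def
    have hcop : Nat.Coprime x'.val L := by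
      refine coprime_of_forall_prime fun p hp hpL ↦ ?_
      by_cases hp3 : p = 3
      · subst hp3; exact hj
      · exact hne3 p hp hpL hp3 j
    refine isStandardQuadruple_of_coprime hcop (Or.inr ⟨⟨R, hR⟩, ?_⟩)
    rw [hR', hx, hx'def]
    -- `γ` is cyclic in its first three entries
    interval_cases j
    · simp
    · have e1 : x + ((1 : ℕ) : ZMod L) * ((R : ℕ) : ZMod L) = x + ((R : ℕ) : ZMod L) := by push_cast; ring
      rw [e1, show x + ((R : ℕ) : ZMod L) + ((R : ℕ) : ZMod L) = x + 2 * ((R : ℕ) : ZMod L) by ring,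
        show x + ((R : ℕ) : ZMod L) + 2 * ((R : ℕ) : ZMod L) = x by linear_combination hRRR,
        show -(3 * (x + ((R : ℕ) : ZMod L))) = -(3 * x) by linear_combination (-1 : ZMod L) * hRRR]
      simp only [Multiset.insert_eq_cons, ← Multiset.singleton_add]
      abel
    · have e2 : x + ((2 : ℕ) : ZMod L) * ((R : ℕ) : ZMod L) = x + 2 * ((R : ℕ) : ZMod L) := by push_cast; ring
      rw [e2, show x + 2 * ((R : ℕ) : ZMod L) + ((R : ℕ) : ZMod L) = x by linear_combination hRRR,
        show x + 2 * ((R : ℕ) : ZMod L) + 2 * ((R : ℕ) : ZMod L) = x + ((R : ℕ) : ZMod L) by linear_combination hRRR,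
        show -(3 * (x + 2 * ((R : ℕ) : ZMod L))) = -(3 * x) by linear_combination (-2 : ZMod L) * hRRR]
      simp only [Multiset.insert_eq_cons, ← Multiset.singleton_add]
      abel

end PrimitiveStandard

/-! ## `StdOrLift 180` ⟺ no exceptional quadruple above `180` -/

section NoExceptional

variable {L : ℕ} [NeZero L]

/-- **`StdOrLift 180 L` from `Δ = 0` at the divisors `> 180` of `L`.** If no level `n > 180` with `L = n·g` carries an
exceptional quadruple, then every pair-free Hodge quadruple of level `L` is standard or a lift from a level `≤ 180`: it is `g·t`
with `t` primitive of level `n = L/g` (`exists_primitive_lift`); for `n ≤ 180` it is such a lift, for `n > 180` the primitive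
`t` is standard, hence so is `g·t`. [cite: Shioda1982PicardFermat, §2 p. 726 (𝔍²ₘ(d) ≅ 𝔍²_{m/d}(1)), Prop. 4 (Q′) p. 729]
[cite: MeyerNeutsch1981Fermatquadrupel, Tabelle 1 p. 54 (levels ≤ 180)] -/
theorem stdOrLift_of_forall_not_isExceptionalQuadruple
    (h : ∀ n g : ℕ, ∀ _ : NeZero n, L = n * g → 180 < n → ∀ t : Multiset (ZMod n), ¬ IsExceptionalQuadruple n t) :
    StdOrLift 180 L := by
  intro s hs hc hpf
  obtain ⟨n, g, _, hLn, hg0, t, hst, htc, htprim, -⟩ := exists_primitive_lift s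
  rcases Nat.lt_or_ge 180 n with hn | hn
  · -- `n > 180`: the primitive quotient is standard
    left
    have ht : IsHodgeMultiset t := by rw [hst, isHodgeMultiset_map_liftBy_iff hLn hg0] at hs; exact hs
    have htc4 : card t = 4 := by rw [htc, hc]
    have htpf : ¬ HasPair t := fun hp ↦ hpf (by rw [hst]; exact hasPair_map_liftBy hLn hp)
    have hstd : IsStandardQuadruple n t := by
      by_contra hns
      exact h n g inferInstance hLn hn t ⟨htc4, ht, htpf, htprim, hns⟩
    rw [hst]
    exact isStdMultiset_map_liftBy hLn (isStdMultiset_of_isStandardQuadruple hstd)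
  · -- `n ≤ 180`: a lift from the level `n`
    right
    refine ⟨g, ⟨n, by rw [hLn, mul_comm]⟩, by rw [hLn]; exact Nat.mul_le_mul_right g hn, fun a ha ↦ ?_⟩
    rw [hst] at ha
    obtain ⟨a', -, rfl⟩ := Multiset.mem_map.mp ha
    rw [liftBy, ZMod.val_natCast]
    exact (Nat.dvd_mod_iff ⟨n, by rw [hLn, mul_comm]⟩).mpr (Dvd.intro_left _ rfl)

/-- **`Δ(L) = 0` from `StdOrLift 180 L`** (`L > 180`): a primitive pair-free Hodge quadruple is not a lift from a level
`≤ 180 < L`, so it is a standard multiset, and being primitive it is a standard quadruple.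
[cite: Shioda1982PicardFermat, Prop. 4 (Q′) p. 729] [cite: MeyerNeutsch1981Fermatquadrupel, p. 53 (Standard- und Ausnahmequadrupel)] -/
theorem not_isExceptionalQuadruple_of_stdOrLift (h : StdOrLift 180 L) (hL : 180 < L) (s : Multiset (ZMod L)) :
    ¬ IsExceptionalQuadruple L s := by
  rintro ⟨hc, hs, hpf, hprim, hns⟩
  rcases h s hs hc hpf with hstd | hlift
  · exact hns (isStandardQuadruple_of_isStdMultiset_of_isPrimitive' hstd hprim)
  · exact not_isPrimitive_of_isLiftLe hL hlift hprim

/-- **The induction interface.** At a level `L > 180`: if `StdOrLift 180` holds at every proper quotient level `n`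
(`L = n·g`, `g ≥ 2`) and every PRIMITIVE pair-free Hodge quadruple of level `L` is a standard multiset, then `StdOrLift 180 L`.
[cite: Shioda1982PicardFermat, §2 p. 726, Prop. 4 (Q′) p. 729] -/
theorem stdOrLift_of_primitive_case
    (IH : ∀ n g : ℕ, ∀ _ : NeZero n, L = n * g → 2 ≤ g → StdOrLift 180 n)
    (hprim : ∀ s : Multiset (ZMod L), IsHodgeMultiset s → card s = 4 → ¬ HasPair s → IsPrimitive L s → IsStdMultiset L s) :
    StdOrLift 180 L := by
  intro s hs hc hpf
  by_cases hp : IsPrimitive L s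
  · exact Or.inl (hprim s hs hc hpf hp)
  · obtain ⟨n, g, _, hLn, hg0, t, hst, htc, htprim, -⟩ := exists_primitive_lift s
    have hg2 : 2 ≤ g := by
      by_contra hg1
      have hg : g = 1 := by omega
      subst hg
      apply hp
      -- `g = 1`: `s = t` up to the identification `ℤ/n = ℤ/L`
      rw [mul_one] at hLn
      subst hLn
      have hid : ∀ a : ZMod L, liftBy L L 1 a = a := fun a ↦ by
        rw [liftBy, mul_one, ZMod.natCast_zmod_val]
      have : s = t := by rw [hst, Multiset.map_congr rfl fun a _ ↦ hid a, Multiset.map_id']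
      rwa [this]
    have hdvd : ∀ w ∈ s, g ∣ w.val := fun w hw ↦ by
      rw [hst] at hw
      obtain ⟨a, -, rfl⟩ := Multiset.mem_map.mp hw
      rw [liftBy, ZMod.val_natCast]
      exact (Nat.dvd_mod_iff ⟨n, by rw [hLn, mul_comm]⟩).mpr (Dvd.intro_left _ rfl)
    exact std_or_lift_of_forall_dvd hLn hg0 (IH n g inferInstance hLn hg2) hs hc hpf hdvd

end NoExceptional

end Literature.AlgebraicGeometry.Shioda1982
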